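import Literature.NumberTheory.EllipticCurves.SecondKindColmezFunctionalHodgeLine
import Literature.NumberTheory.PAdicHodge.FormalLogSecondKindCongruentLaws
import HarnessLib

/-!
# Values of second-kind series and of the formal logarithm for a Weierstrass equation with coefficients in a ring `A` acting
# on `𝒪_K` (e.g. the ramified `𝒪_D = ℤ_p[ϖ]`): `‖G(F_W(s,t)) − G(s) − G(t)‖ ≤ C`, `log_W(F_W(s,t)) = log_W(s) + log_W(t)`,
# `log_W([n]_W t) = n·log_W(t)`, and `pᵐ·log_W(u_m) = log_W(u₀)` along an exact `[p]_W`-division tower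

Topic `Literature/NumberTheory/EllipticCurves`; namespace `Literature.NumberTheory.EllipticCurves`. THEOREMS ONLY (no definition, no named
fact, no instance, no `sorry`). This is `SecondKindSeriesValueCocycle` (J1, stated for `W/ℤ`) and the additivity half of
`FormalGroupLimitLogSeries.tsum_coeff_formalLog_mul_pow_evF` (`W/ℤ`) for a Weierstrass equation `W` over ANY discrete coefficient ring `A` with
`[Algebra A (unitBall K)]` (so `φ := 𝒪_K.subtype ∘ algebraMap A 𝒪_K : A → K` has norm `≤ 1`), `K` a complete nontrivially normed ultrametric
field; values `G(x) := Σ' [Xⁿ]G·xⁿ` on `𝔪_K = ballNilIdeal K`, `F_W(s,t) = evF W s t`, `[n]_W t = evalPt₁ (W.formalMul n) t`.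

* §1 `norm_coe_evalPt_sub_aeval_map_truncTotal_le` — **`‖f(x) − (φ_* f_{≤D})(x)‖ ≤ ρ^{D+1}`** for `f ∈ A⟦X_ι⟧` at a point of `𝔪_K` with `‖xᵢ‖ ≤ ρ`;
  `norm_coe_evF_sub_aeval_map_truncTotal_le`; `norm_coeff_map_pow_le_one`; `norm_coeff_aeval_trunc_sub_le_of_coeff_pow_le`.
* §2 ★★ `norm_tsum_evF_sub_tsum_sub_tsum_le_of_algebra` — **the value cocycle bound `‖G(F_W(s,t)) − G(s) − G(t)‖ ≤ C`** for `W/A`, `G ∈ K⟦X⟧`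
  with `‖[Xⁿ]G‖ ≤ n^k` and `φ_*F_W`-coboundary coefficients `≤ C` (J1's truncation argument verbatim).
* §3 The formal logarithm `log_W := (W.map φ).formalLog` (`K` of characteristic `0`, `‖p‖ < 1`): `exists_nat_norm_coeff_formalLog_map_le_pow_of_algebra`
  (`‖[Xⁿ]log_W‖ ≤ n^k`), `formalLog_map_cocycle_eq_zero_of_algebra`, ★★ `tsum_coeff_formalLog_map_evF` (**`log_W(F_W(s,t)) = log_W(s) + log_W(t)`**),
  ★ `tsum_coeff_formalLog_map_formalMul` (**`log_W([n]_W t) = n·log_W(t)`**), ★★ `pow_mul_tsum_coeff_formalLog_map_divisionSeq`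
  (**`pᵐ·log_W(u_m) = log_W(u₀)`** along an exact `[p]_W`-division tower `u`) — the hypothesis `hu` of
  `SecondKindColmezFunctionalHodgeLine.tsum_eq_of_hodgeLine_of_pow_mul_tsum_eq`.

Purpose (crux K★ `stmt-BirchSwinnertonDyer-22226`, line `kato_lever`, memo `Lines/kato-lever-K2-ramified-cm-transport.md` §9, step J4): applied with
`A = 𝒪_D = ℤ_p[ϖ]` (`EisensteinRoot.CoeffDisc D`), `K = ℂ_F`, `W = W_D` the ramified good model of a K★ cell and `u` the Kummer tower of a
rational point, §3 gives `pᵐ·log_{W_D}(u_m) = log_{W_D}(u₀)`, so that (HL-eval) reads `log_{W_D}(u₀) = α·log_{E₀}((Tu)₀) + β·𝒞_{Tu}(log_{E₀}(Xᵖ))`.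
Infrastructure only; BSD / K★ are not proved by any of this; nothing about elliptic curves over number fields is proved here.

## References
* N. M. Katz, *Crystalline cohomology, Dieudonné modules, and Jacobi sums* (1981), §5.1, Key Lemma 5.1.3. [Katz1981CrystallineDieudonne]
* J. H. Silverman, *The Arithmetic of Elliptic Curves* (2009), IV.2.3, IV.5.2, Thm. IV.6.4, Prop. VII.2.2. [SilvermanAEC2009]
* J.-P. Serre, *Local class field theory*, in Cassels–Fröhlich (1967), Ch. VI §3.2. [CasselsFrohlichANT1967]
-/

noncomputable section

open scoped Classical Topology
open PowerSeries Filter Finset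

namespace Literature.NumberTheory.EllipticCurves

open Literature.NumberTheory.GaloisRepresentations.LubinTate Literature.NumberTheory.PAdicHodge Literature.RingTheory.FormalGroups

section IntegralCoeff

variable {K : Type*} [NontriviallyNormedField K] [IsUltrametricDist K] [CompleteSpace K]
  {A : Type*} [CommRing A] [UniformSpace A] [DiscreteUniformity A] [Algebra A (unitBall K)] [ContinuousSMul A (unitBall K)]

/-! ## §1 Truncations approximate point values, for `A`-coefficients -/

omit [CompleteSpace K] [UniformSpace A] [DiscreteUniformity A] [ContinuousSMul A (unitBall K)] in
/-- The coefficient map `φ = 𝒪_K ↪ K ∘ (A → 𝒪_K)` has norm `≤ 1`. [cite: CasselsFrohlichANT1967, Ch. VI §3.2] -/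
theorem norm_subtype_comp_algebraMap_le_one (a : A) : ‖((unitBall K).subtype.comp (algebraMap A (unitBall K))) a‖ ≤ 1 :=
  (mem_unitBall_iff K).mp (algebraMap A (unitBall K) a).2

omit [CompleteSpace K] [UniformSpace A] [DiscreteUniformity A] [ContinuousSMul A (unitBall K)] in
/-- Reading an `A`-polynomial value in `K`: `↑(T(x)) = (φ_*T)(↑x)`. [cite: CasselsFrohlichANT1967, Ch. VI §3.2] -/
theorem coe_aeval_eq_aeval_map {ι : Type*} (x : ι → (ballNilIdeal K).toIdeal) (T : MvPolynomial ι A) :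
    ((MvPolynomial.aeval (fun i => (x i : unitBall K)) T : unitBall K) : K) =
      MvPolynomial.aeval (fun i => ((x i : unitBall K) : K)) (MvPolynomial.map ((unitBall K).subtype.comp (algebraMap A (unitBall K))) T) := by
  rw [MvPolynomial.aeval_def, MvPolynomial.aeval_def, MvPolynomial.eval₂_map, Algebra.algebraMap_self, RingHom.id_comp,
    show (((MvPolynomial.eval₂ (algebraMap A (unitBall K)) (fun i => (x i : unitBall K)) T : unitBall K)) : K) =
      (unitBall K).subtype (MvPolynomial.eval₂ (algebraMap A (unitBall K)) (fun i => (x i : unitBall K)) T) from rfl,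
    MvPolynomial.eval₂_comp_left]
  rfl

omit [IsUltrametricDist K] in
/-- In an ultrametric group, a `HasSum` all of whose terms have norm `≤ C` has norm `≤ C`. [folklore] -/
private theorem norm_le_of_hasSum_of_forall_norm_le'' {G : Type*} [SeminormedAddCommGroup G] [IsUltrametricDist G] {ι : Type*}
    {f : ι → G} {a : G} (ha : HasSum f a) {C : ℝ} (hC : 0 ≤ C) (h : ∀ i, ‖f i‖ ≤ C) : ‖a‖ ≤ C :=
  (isClosed_le continuous_norm continuous_const).mem_of_tendsto ha
    (Eventually.of_forall fun _ => IsUltrametricDist.norm_sum_le_of_forall_le_of_nonneg hC fun i _ => h i)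

/-- ★ **Truncations approximate point values: `‖f(x) − (φ_*f_{≤D})(x)‖ ≤ ρ^{D+1}`** for `f ∈ A⟦X_ι⟧` without constant term at a point `x` of `𝔪_K`
with `‖xᵢ‖ ≤ ρ ≤ 1` (the tail has all monomials of degree `≥ D+1` and coefficients of norm `≤ 1`). [cite: CasselsFrohlichANT1967, Ch. VI §3.2] -/
theorem norm_coe_evalPt_sub_aeval_map_truncTotal_le {ι : Type*} [Fintype ι] (f : MvPowerSeries ι A) (hf : f.constantCoeff = 0)
    (x : ι → (ballNilIdeal K).toIdeal) {ρ : ℝ} (hρ0 : 0 ≤ ρ) (hρ1 : ρ ≤ 1) (hx : ∀ i, ‖((x i : unitBall K) : K)‖ ≤ ρ) (D : ℕ) :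
    ‖(((evalPt (ballNilIdeal K) f hf x : (ballNilIdeal K).toIdeal) : unitBall K) : K) -
        MvPolynomial.aeval (fun i => ((x i : unitBall K) : K))
          (MvPolynomial.map ((unitBall K).subtype.comp (algebraMap A (unitBall K))) (MvPowerSeries.truncTotal (D + 1) f))‖ ≤ ρ ^ (D + 1) := by
  classical
  have hev := (ballNilIdeal K).hasEval x
  set g : MvPowerSeries ι A := f - ((MvPowerSeries.truncTotal (D + 1) f : MvPolynomial ι A) : MvPowerSeries ι A) with hg
  have hsplit : (((evalPt (ballNilIdeal K) f hf x : (ballNilIdeal K).toIdeal) : unitBall K) : K) -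
      MvPolynomial.aeval (fun i => ((x i : unitBall K) : K))
        (MvPolynomial.map ((unitBall K).subtype.comp (algebraMap A (unitBall K))) (MvPowerSeries.truncTotal (D + 1) f)) =
        ((MvPowerSeries.aeval hev g : unitBall K) : K) := by
    rw [← coe_aeval_eq_aeval_map, coe_evalPt, hg, map_sub, MvPowerSeries.aeval_coe, AddSubgroupClass.coe_sub]
  rw [hsplit]
  have hsum : HasSum (fun d : ι →₀ ℕ => (((MvPowerSeries.coeff d g • d.prod fun i e => (x i : unitBall K) ^ e : unitBall K)) : K))
      ((MvPowerSeries.aeval hev g : unitBall K) : K) :=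
    (MvPowerSeries.hasSum_aeval hev g).map (unitBall K).subtype.toAddMonoidHom continuous_subtype_val
  refine norm_le_of_hasSum_of_forall_norm_le'' hsum (pow_nonneg hρ0 _) fun d => ?_
  by_cases hd : d.degree < D + 1
  · have h0 : MvPowerSeries.coeff d g = 0 := by
      rw [hg, map_sub, MvPolynomial.coeff_coe, MvPowerSeries.coeff_truncTotal _ hd, sub_self]
    rw [h0, zero_smul, ZeroMemClass.coe_zero, norm_zero]
    exact pow_nonneg hρ0 _
  · rw [Algebra.smul_def, Subring.coe_mul, norm_mul]
    refine (mul_le_of_le_one_left (norm_nonneg _) ((mem_unitBall_iff K).mp (algebraMap A (unitBall K) _).2)).trans ?_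
    rw [Finsupp.prod, SubmonoidClass.coe_finsetProd, norm_prod]
    calc ∏ i ∈ d.support, ‖(((x i : unitBall K) ^ d i : unitBall K) : K)‖ ≤ ∏ i ∈ d.support, ρ ^ d i :=
          Finset.prod_le_prod (fun i _ => norm_nonneg _) fun i _ => by
            rw [SubmonoidClass.coe_pow, norm_pow]; exact pow_le_pow_left₀ (norm_nonneg _) (hx i) _
      _ = ρ ^ d.degree := by rw [Finset.prod_pow_eq_pow_sum]; rfl
      _ ≤ ρ ^ (D + 1) := pow_le_pow_of_le_one hρ0 hρ1 (not_lt.1 hd)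

/-- For the chord–tangent law of `W/A`: `‖F_W(s,t) − (φ_*(F_W)_{≤D})(s,t)‖ ≤ ρ^{D+1}`, `ρ = max(‖s‖, ‖t‖)`. [cite: SilvermanAEC2009, Prop. VII.2.2] -/
theorem norm_coe_evF_sub_aeval_map_truncTotal_le (W : WeierstrassCurve A) (s t : (ballNilIdeal K).toIdeal) (D : ℕ) :
    ‖(((evF W s t : (ballNilIdeal K).toIdeal) : unitBall K) : K) -
        MvPolynomial.aeval ![((s : unitBall K) : K), ((t : unitBall K) : K)]
          (MvPolynomial.map ((unitBall K).subtype.comp (algebraMap A (unitBall K))) (MvPowerSeries.truncTotal (D + 1) W.formalGroupLaw))‖ ≤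
      max ‖((s : unitBall K) : K)‖ ‖((t : unitBall K) : K)‖ ^ (D + 1) := by
  have hx : (fun i => (((![s, t] : Fin 2 → (ballNilIdeal K).toIdeal) i : unitBall K) : K)) =
      ![((s : unitBall K) : K), ((t : unitBall K) : K)] := by
    funext i; fin_cases i <;> rfl
  have h := norm_coe_evalPt_sub_aeval_map_truncTotal_le (K := K) W.formalGroupLaw W.constantCoeff_formalGroupLaw ![s, t]
    (ρ := max ‖((s : unitBall K) : K)‖ ‖((t : unitBall K) : K)‖) (le_max_of_le_left (norm_nonneg _))
    (max_le (norm_lt_one_of_mem s).le (norm_lt_one_of_mem t).le) (fun i => by fin_cases i <;> simp) D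
  rwa [hx] at h

omit [CompleteSpace K] [UniformSpace A] [DiscreteUniformity A] [ContinuousSMul A (unitBall K)] in
/-- The coefficients of a power of `φ_*T`, `T ∈ A[X_τ]`, have norm `≤ 1`. [cite: SilvermanAEC2009, IV.2] -/
theorem norm_coeff_map_pow_le_one {τ : Type*} (T : MvPolynomial τ A) (n : ℕ) (d : τ →₀ ℕ) :
    ‖MvPolynomial.coeff d (MvPolynomial.map ((unitBall K).subtype.comp (algebraMap A (unitBall K))) T ^ n)‖ ≤ 1 := by
  rw [← MvPolynomial.coeff_coe, MvPolynomial.coe_pow]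
  refine (norm_coeff_pow_le_mv (K := K)
    (f := ((MvPolynomial.map ((unitBall K).subtype.comp (algebraMap A (unitBall K))) T : MvPolynomial τ K) : MvPowerSeries τ K))
    zero_le_one (fun d' => ?_) n d).trans (by rw [one_pow])
  rw [MvPolynomial.coeff_coe, MvPolynomial.coeff_map]
  exact norm_subtype_comp_algebraMap_le_one _

omit [CompleteSpace K] [UniformSpace A] [DiscreteUniformity A] [Algebra A (unitBall K)] [ContinuousSMul A (unitBall K)] in
/-- **Coefficients of `G_{≤M}(U) − G_{≤M}(X₀) − G_{≤M}(X₁)` are `≤ M^k`** for a `K`-polynomial `U` all of whose powers have coefficients `≤ 1`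
and `‖cₙ‖ ≤ n^k`. [cite: Katz1981CrystallineDieudonne, §5.1] -/
theorem norm_coeff_aeval_trunc_sub_le_of_coeff_pow_le (G : PowerSeries K) (k : ℕ) (hk : ∀ n, ‖PowerSeries.coeff n G‖ ≤ (n : ℝ) ^ k)
    (hG0 : PowerSeries.constantCoeff G = 0) (U : MvPolynomial (Fin 2) K) (hU : ∀ i e, ‖MvPolynomial.coeff e (U ^ i)‖ ≤ 1) (M : ℕ)
    (d : Fin 2 →₀ ℕ) :
    ‖MvPolynomial.coeff d (Polynomial.aeval U (PowerSeries.trunc (M + 1) G) -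
        Polynomial.aeval (MvPolynomial.X 0 : MvPolynomial (Fin 2) K) (PowerSeries.trunc (M + 1) G) -
        Polynomial.aeval (MvPolynomial.X 1 : MvPolynomial (Fin 2) K) (PowerSeries.trunc (M + 1) G))‖ ≤ (M : ℝ) ^ k := by
  have hc : ∀ i ∈ range (M + 1), ‖PowerSeries.coeff i G‖ ≤ (M : ℝ) ^ k := by
    intro i hi
    rcases Nat.eq_zero_or_pos i with rfl | hi0
    · rw [PowerSeries.coeff_zero_eq_constantCoeff, hG0, norm_zero]; positivity
    · exact (hk i).trans (pow_le_pow_left₀ (Nat.cast_nonneg _) (by exact_mod_cast Nat.lt_succ_iff.mp (mem_range.mp hi)) k)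
  have hterm : ∀ (V : MvPolynomial (Fin 2) K), (∀ i e, ‖MvPolynomial.coeff e (V ^ i)‖ ≤ 1) →
      ‖MvPolynomial.coeff d (Polynomial.aeval V (PowerSeries.trunc (M + 1) G))‖ ≤ (M : ℝ) ^ k := by
    intro V hV
    rw [Polynomial.aeval_def, PowerSeries.eval₂_trunc_eq_sum_range, MvPolynomial.coeff_sum]
    refine IsUltrametricDist.norm_sum_le_of_forall_le_of_nonneg (by positivity) fun i hi => ?_
    rw [MvPolynomial.algebraMap_eq, MvPolynomial.coeff_C_mul, norm_mul]
    exact (mul_le_mul (hc i hi) (hV i d) (norm_nonneg _) (by positivity)).trans (by rw [mul_one])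
  have hX : ∀ (j : Fin 2) (i : ℕ) (e : Fin 2 →₀ ℕ), ‖MvPolynomial.coeff e ((MvPolynomial.X j : MvPolynomial (Fin 2) K) ^ i)‖ ≤ 1 := by
    intro j i e
    have h := norm_coeff_map_int_pow_le_one (K := K) (MvPolynomial.X j : MvPolynomial (Fin 2) ℤ) i e
    rwa [MvPolynomial.map_X] at h
  have hsub : ∀ a b : MvPolynomial (Fin 2) K, ‖MvPolynomial.coeff d (a - b)‖ ≤ max ‖MvPolynomial.coeff d a‖ ‖MvPolynomial.coeff d b‖ :=
    fun a b => by rw [MvPolynomial.coeff_sub, sub_eq_add_neg, ← norm_neg (MvPolynomial.coeff d b)]; exact IsUltrametricDist.norm_add_le_max _ _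
  refine (hsub _ _).trans (max_le ((hsub _ _).trans (max_le ?_ ?_)) ?_)
  · exact hterm _ hU
  · exact hterm _ (hX 0)
  · exact hterm _ (hX 1)

/-! ## §2 The value cocycle bound for `W/A` -/

/-- ★★ **Values of a series of the second kind, `A`-coefficients.** Let `W/A`, `G = Σ cₙXⁿ ∈ K⟦X⟧` with `c₀ = 0`, `‖cₙ‖ ≤ n^k`, and suppose the
`φ_*F_W`-coboundary `G(F_W(X,Y)) − G(X) − G(Y)` has all coefficients of norm `≤ C`. Then **`‖G(F_W(s,t)) − G(s) − G(t)‖ ≤ C`** for all `s, t ∈ 𝔪_K`.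
[cite: Katz1981CrystallineDieudonne, §5.1, Key Lemma 5.1.3] -/
theorem norm_tsum_evF_sub_tsum_sub_tsum_le_of_algebra (W : WeierstrassCurve A) (G : PowerSeries K) (hG0 : PowerSeries.constantCoeff G = 0) (k : ℕ)
    (hk : ∀ n, ‖PowerSeries.coeff n G‖ ≤ (n : ℝ) ^ k) {C : ℝ} (hC0 : 0 ≤ C)
    (hC : ∀ d : Fin 2 →₀ ℕ, ‖MvPowerSeries.coeff d (G.subst (W.map ((unitBall K).subtype.comp (algebraMap A (unitBall K)))).formalGroupLaw -
      G.subst (MvPowerSeries.X 0 : MvPowerSeries (Fin 2) K) - G.subst (MvPowerSeries.X 1 : MvPowerSeries (Fin 2) K))‖ ≤ C)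
    (s t : (ballNilIdeal K).toIdeal) :
    ‖∑' n : ℕ, PowerSeries.coeff n G * (((evF W s t : (ballNilIdeal K).toIdeal) : unitBall K) : K) ^ n -
        ∑' n : ℕ, PowerSeries.coeff n G * ((s : unitBall K) : K) ^ n -
        ∑' n : ℕ, PowerSeries.coeff n G * ((t : unitBall K) : K) ^ n‖ ≤ C := by
  -- notation
  set φ : A →+* K := (unitBall K).subtype.comp (algebraMap A (unitBall K)) with hφ
  set c : ℕ → K := fun n => PowerSeries.coeff n G with hc
  set σ : K := ((s : unitBall K) : K) with hσ
  set τ : K := ((t : unitBall K) : K) with hτ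
  set g : K := (((evF W s t : (ballNilIdeal K).toIdeal) : unitBall K) : K) with hgdef
  have hσ1 : ‖σ‖ < 1 := norm_lt_one_of_mem s
  have hτ1 : ‖τ‖ < 1 := norm_lt_one_of_mem t
  have hg1 : ‖g‖ < 1 := norm_lt_one_of_mem _
  set ρ : ℝ := max ‖σ‖ ‖τ‖ with hρ
  have hρ0 : 0 ≤ ρ := le_max_of_le_left (norm_nonneg _)
  have hρ1 : ρ < 1 := max_lt hσ1 hτ1
  -- partial sums `S M x = G_{≤M}(x)` and their limits
  set S : ℕ → K → K := fun M x => Polynomial.aeval x (PowerSeries.trunc (M + 1) G) with hS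
  have hSsum : ∀ M x, S M x = ∑ n ∈ range (M + 1), c n * x ^ n := fun M x => by
    rw [hS]
    simp only
    rw [Polynomial.aeval_def, PowerSeries.eval₂_trunc_eq_sum_range]
    exact Finset.sum_congr rfl fun n _ => rfl
  have hlim : ∀ {x : K}, ‖x‖ < 1 → Tendsto (fun M => S M x) atTop (𝓝 (∑' n : ℕ, c n * x ^ n)) := fun {x} hx => by
    have h := (tendsto_sum_range_coeff_mul_pow G k hk hx).comp (tendsto_add_atTop_nat 1)
    refine h.congr fun M => ?_
    rw [Function.comp_apply, hSsum]
  -- the truncated group law `T_M` (over `A`), its value `GM M ∈ K`, and the distance to `g`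
  set T : ℕ → MvPolynomial (Fin 2) A := fun M => MvPowerSeries.truncTotal (M + 1) W.formalGroupLaw with hT
  set GM : ℕ → K := fun M => MvPolynomial.aeval ![σ, τ] (MvPolynomial.map φ (T M)) with hGM
  have hgG : ∀ M, ‖g - GM M‖ ≤ ρ ^ (M + 1) := fun M => norm_coe_evF_sub_aeval_map_truncTotal_le W s t M
  have hG1 : ∀ M, ‖GM M‖ ≤ 1 := fun M => by
    have h : GM M = g + (-(g - GM M)) := by ring
    rw [h]
    refine (IsUltrametricDist.norm_add_le_max _ _).trans (max_le hg1.le ?_)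
    rw [norm_neg]; exact (hgG M).trans (pow_le_one₀ hρ0 hρ1.le)
  -- the polynomial cocycle `Q_M = G_M(φ_*T_M) − G_M(X₀) − G_M(X₁)` and its value
  set Q : ℕ → MvPolynomial (Fin 2) K := fun M =>
    Polynomial.aeval (MvPolynomial.map φ (T M)) (PowerSeries.trunc (M + 1) G) -
      Polynomial.aeval (MvPolynomial.X 0 : MvPolynomial (Fin 2) K) (PowerSeries.trunc (M + 1) G) -
      Polynomial.aeval (MvPolynomial.X 1 : MvPolynomial (Fin 2) K) (PowerSeries.trunc (M + 1) G) with hQ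
  have hQval : ∀ M, MvPolynomial.aeval ![σ, τ] (Q M) = S M (GM M) - S M σ - S M τ := fun M => by
    rw [hQ]
    simp only [map_sub]
    rw [← Polynomial.aeval_algHom_apply, ← Polynomial.aeval_algHom_apply, ← Polynomial.aeval_algHom_apply,
      MvPolynomial.aeval_X, MvPolynomial.aeval_X]
    rfl
  -- `Q_M` agrees with the coboundary below degree `M + 1`
  have hQtrunc : ∀ M, 1 ≤ M → MvPowerSeries.truncTotal (M + 1) ((Q M : MvPolynomial (Fin 2) K) : MvPowerSeries (Fin 2) K) =
      MvPowerSeries.truncTotal (M + 1) (G.subst (W.map φ).formalGroupLaw -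
        G.subst (MvPowerSeries.X 0 : MvPowerSeries (Fin 2) K) - G.subst (MvPowerSeries.X 1 : MvPowerSeries (Fin 2) K)) := by
    intro M hM
    have hX : ∀ j : Fin 2, MvPowerSeries.truncTotal (M + 1) (MvPowerSeries.X j : MvPowerSeries (Fin 2) K) = MvPolynomial.X j := fun j => by
      rw [← MvPolynomial.coe_X, MvPowerSeries.truncTotal_coe_eq_self_iff _ (Nat.succ_ne_zero M), MvPolynomial.totalDegree_X]
      omega
    have hF : MvPowerSeries.truncTotal (M + 1) (W.map φ).formalGroupLaw = MvPolynomial.map φ (T M) := by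
      rw [← WeierstrassCurve.map_formalGroupLaw, map_truncTotal']
    rw [map_sub, map_sub, truncTotal_subst_eq_truncTotal_coe_aeval G _ (W.map φ).constantCoeff_formalGroupLaw,
      truncTotal_subst_eq_truncTotal_coe_aeval G _ (MvPowerSeries.constantCoeff_X 0),
      truncTotal_subst_eq_truncTotal_coe_aeval G _ (MvPowerSeries.constantCoeff_X 1), hF, hX 0, hX 1, hQ]
    simp only [← map_sub (MvPowerSeries.truncTotal (M + 1) : MvPowerSeries (Fin 2) K →ₗ[K] MvPolynomial (Fin 2) K)]
    congr 1
  -- the estimate `‖Q_M(σ, τ)‖ ≤ max C (M^k ρ^{M+1})`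
  have hQest : ∀ M, 1 ≤ M → ‖MvPolynomial.aeval ![σ, τ] (Q M)‖ ≤ max C ((M : ℝ) ^ k * ρ ^ (M + 1)) := by
    intro M hM
    have hy : ∀ i, ‖(![σ, τ] : Fin 2 → K) i‖ ≤ ρ := fun i => by fin_cases i <;> simp [hρ]
    have hcoefQ : ∀ d, ‖MvPolynomial.coeff d (Q M)‖ ≤ (M : ℝ) ^ k := fun d =>
      norm_coeff_aeval_trunc_sub_le_of_coeff_pow_le G k hk hG0 _ (fun i e => norm_coeff_map_pow_le_one (T M) i e) M d
    set Qlow : MvPolynomial (Fin 2) K := MvPowerSeries.truncTotal (M + 1) ((Q M : MvPolynomial (Fin 2) K) : MvPowerSeries (Fin 2) K) with hQlow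
    have hsplit : Q M = Qlow + (Q M - Qlow) := by ring
    rw [hsplit, map_add]
    refine (IsUltrametricDist.norm_add_le_max _ _).trans (max_le_max ?_ ?_)
    · have h := norm_aeval_le_mul_pow_of_coeff hρ0 hρ1.le hy (q := Qlow) hC0 (fun d => ?_) (N := 0) (fun d hd => absurd hd (Nat.not_lt_zero _))
      · rwa [pow_zero, mul_one] at h
      · rw [hQlow, hQtrunc M hM, MvPowerSeries.coeff_truncTotal_eq_ite]
        split_ifs
        · exact hC d
        · rw [norm_zero]; exact hC0
    · refine norm_aeval_le_mul_pow_of_coeff hρ0 hρ1.le hy (by positivity) (fun d => ?_) (fun d hd => ?_)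
      · rw [MvPolynomial.coeff_sub, hQlow, MvPowerSeries.coeff_truncTotal_eq_ite, MvPolynomial.coeff_coe]
        split_ifs
        · rw [sub_self, norm_zero]; positivity
        · rw [sub_zero]; exact hcoefQ d
      · rw [MvPolynomial.coeff_sub, hQlow, MvPowerSeries.coeff_truncTotal _ hd, MvPolynomial.coeff_coe, sub_self]
  -- replacing `G_M(φ_*T_M(σ,τ))` by `G_M(g)`
  have hd : ∀ M, ‖S M g - S M (GM M)‖ ≤ (M : ℝ) ^ k * ρ ^ (M + 1) := fun M => by
    have h : S M g - S M (GM M) = ∑ n ∈ range (M + 1), c n * (g ^ n - GM M ^ n) := by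
      rw [hSsum, hSsum, ← Finset.sum_sub_distrib]
      exact Finset.sum_congr rfl fun n _ => by rw [mul_sub]
    rw [h]
    refine IsUltrametricDist.norm_sum_le_of_forall_le_of_nonneg (by positivity) fun n hn => ?_
    rw [norm_mul]
    have hcn : ‖c n‖ ≤ (M : ℝ) ^ k := by
      rcases Nat.eq_zero_or_pos n with rfl | hn0
      · rw [hc]; simp only; rw [PowerSeries.coeff_zero_eq_constantCoeff, hG0, norm_zero]; positivity
      · exact (hk n).trans (pow_le_pow_left₀ (Nat.cast_nonneg _) (by exact_mod_cast Nat.lt_succ_iff.mp (mem_range.mp hn)) k)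
    exact mul_le_mul hcn ((norm_pow_sub_pow_le hg1.le (hG1 M) _).trans (hgG M)) (norm_nonneg _) (by positivity)
  -- total error
  have herr : ∀ᶠ M in atTop, ‖S M g - S M σ - S M τ‖ ≤ max C ((M : ℝ) ^ k * ρ ^ (M + 1)) := by
    refine Filter.eventually_atTop.2 ⟨1, fun M hM => ?_⟩
    have h : S M g - S M σ - S M τ = (S M g - S M (GM M)) + (S M (GM M) - S M σ - S M τ) := by ring
    rw [h, ← hQval]
    exact (IsUltrametricDist.norm_add_le_max _ _).trans (max_le (le_max_of_le_right (hd M)) (hQest M hM))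
  have hbound : Tendsto (fun M : ℕ => max C ((M : ℝ) ^ k * ρ ^ (M + 1))) atTop (𝓝 C) := by
    have h := (tendsto_pow_const_mul_const_pow_of_abs_lt_one k (r := ρ) (by rwa [abs_of_nonneg hρ0])).mul_const ρ
    rw [zero_mul] at h
    have h' : Tendsto (fun M : ℕ => (M : ℝ) ^ k * ρ ^ (M + 1)) atTop (𝓝 0) := h.congr fun M => by ring
    have := (tendsto_const_nhds (x := C)).max h'
    rwa [max_eq_left hC0] at this
  have hlim3 : Tendsto (fun M => ‖S M g - S M σ - S M τ‖) atTop
      (𝓝 ‖∑' n : ℕ, c n * g ^ n - ∑' n : ℕ, c n * σ ^ n - ∑' n : ℕ, c n * τ ^ n‖) :=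
    (((hlim hg1).sub (hlim hσ1)).sub (hlim hτ1)).norm
  exact le_of_tendsto_of_tendsto hlim3 hbound herr

end IntegralCoeff

/-! ## §3 The formal logarithm of `W/A`: additivity of values, `[n]`, and division towers -/

section FormalLog

variable {K : Type*} [NontriviallyNormedField K] [IsUltrametricDist K] [CompleteSpace K] [CharZero K]
  {A : Type*} [CommRing A] [UniformSpace A] [DiscreteUniformity A] [Algebra A (unitBall K)] [ContinuousSMul A (unitBall K)]
  (W : WeierstrassCurve A) {p : ℕ} [hp : Fact p.Prime]

omit [CompleteSpace K] [UniformSpace A] [DiscreteUniformity A] [ContinuousSMul A (unitBall K)] in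
/-- **`‖[Xⁿ]log_W‖ ≤ n^k`** for `log_W = (W.map φ).formalLog` (log-type: `‖n·[Xⁿ]log_W‖ ≤ 1`, tree `norm_natCast_mul_coeff_formalLog_map_le_one'`, and
`‖n⁻¹‖ ≤ n^k`). [cite: SilvermanAEC2009, IV.5.5] -/
theorem exists_nat_norm_coeff_formalLog_map_le_pow_of_algebra (hpK : ‖(p : K)‖ < 1) :
    ∃ k : ℕ, ∀ n : ℕ, ‖PowerSeries.coeff n (W.map ((unitBall K).subtype.comp (algebraMap A (unitBall K)))).formalLog‖ ≤ (n : ℝ) ^ k := by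
  obtain ⟨k, hk⟩ := exists_nat_norm_inv_natCast_le_pow (K := K) hpK
  refine ⟨k, fun n => ?_⟩
  rcases Nat.eq_zero_or_pos n with rfl | hn
  · rw [PowerSeries.coeff_zero_eq_constantCoeff, WeierstrassCurve.constantCoeff_formalLog, norm_zero]
    positivity
  · have h1 := norm_natCast_mul_coeff_formalLog_map_le_one' ((unitBall K).subtype.comp (algebraMap A (unitBall K)))
      norm_subtype_comp_algebraMap_le_one W n
    have hn0 : (n : K) ≠ 0 := Nat.cast_ne_zero.2 hn.ne'
    calc ‖PowerSeries.coeff n (W.map ((unitBall K).subtype.comp (algebraMap A (unitBall K)))).formalLog‖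
        = ‖(n : K)⁻¹ * ((n : K) * PowerSeries.coeff n (W.map ((unitBall K).subtype.comp (algebraMap A (unitBall K)))).formalLog)‖ := by
          rw [← mul_assoc, inv_mul_cancel₀ hn0, one_mul]
      _ ≤ ‖(n : K)⁻¹‖ * 1 := by rw [norm_mul]; exact mul_le_mul_of_nonneg_left h1 (norm_nonneg _)
      _ ≤ (n : ℝ) ^ k := by rw [mul_one]; exact hk n

omit [CompleteSpace K] [UniformSpace A] [DiscreteUniformity A] [ContinuousSMul A (unitBall K)] hp in
/-- `log_W(F_W(X₀,X₁)) − log_W(X₀) − log_W(X₁) = 0` for `W/A` read in `K` (AEC IV.5.2). [cite: SilvermanAEC2009, IV.5.2] -/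
theorem formalLog_map_cocycle_eq_zero_of_algebra :
    (W.map ((unitBall K).subtype.comp (algebraMap A (unitBall K)))).formalLog.subst
        (W.map ((unitBall K).subtype.comp (algebraMap A (unitBall K)))).formalGroupLaw -
      (W.map ((unitBall K).subtype.comp (algebraMap A (unitBall K)))).formalLog.subst (MvPowerSeries.X 0 : MvPowerSeries (Fin 2) K) -
      (W.map ((unitBall K).subtype.comp (algebraMap A (unitBall K)))).formalLog.subst (MvPowerSeries.X 1 : MvPowerSeries (Fin 2) K) = 0 := by
  rw [(W.map ((unitBall K).subtype.comp (algebraMap A (unitBall K)))).formalLog_subst_formalGroupLaw, sub_sub, sub_self]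

/-- ★★ **`log_W(F_W(s,t)) = log_W(s) + log_W(t)` for `s, t ∈ 𝔪_K`** and `W` over ANY coefficient ring `A` acting on `𝒪_K` (AEC IV.6.4(a); the
series `log_W = (W.map φ).formalLog` evaluated as `Σ' [Xⁿ]log_W·xⁿ`). [cite: SilvermanAEC2009, Thm. IV.6.4] -/
theorem tsum_coeff_formalLog_map_evF (hpK : ‖(p : K)‖ < 1) (s t : (ballNilIdeal K).toIdeal) :
    ∑' n : ℕ, PowerSeries.coeff n (W.map ((unitBall K).subtype.comp (algebraMap A (unitBall K)))).formalLog *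
        (((evF W s t : (ballNilIdeal K).toIdeal) : unitBall K) : K) ^ n =
      ∑' n : ℕ, PowerSeries.coeff n (W.map ((unitBall K).subtype.comp (algebraMap A (unitBall K)))).formalLog * ((s : unitBall K) : K) ^ n +
        ∑' n : ℕ, PowerSeries.coeff n (W.map ((unitBall K).subtype.comp (algebraMap A (unitBall K)))).formalLog *
          ((t : unitBall K) : K) ^ n := by
  obtain ⟨k, hk⟩ := exists_nat_norm_coeff_formalLog_map_le_pow_of_algebra W hpK
  have h := norm_tsum_evF_sub_tsum_sub_tsum_le_of_algebra W _ (WeierstrassCurve.constantCoeff_formalLog _) k hk le_rfl (fun d => ?_) s t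
  · rw [norm_le_zero_iff, sub_sub, sub_eq_zero] at h
    exact h
  · rw [formalLog_map_cocycle_eq_zero_of_algebra, map_zero, norm_zero]

/-- ★ **`log_W([n]_W t) = n·log_W(t)`** for `n ≥ 1` (`[n+1]_W t = F_W([n]_W t, t)`, tree `Pt.evalPt₁_formalMul_succ`). [cite: SilvermanAEC2009, IV.2.3] -/
theorem tsum_coeff_formalLog_map_formalMul (hpK : ‖(p : K)‖ < 1) (t : (ballNilIdeal K).toIdeal) {n : ℕ} (hn : 1 ≤ n) :
    ∑' m : ℕ, PowerSeries.coeff m (W.map ((unitBall K).subtype.comp (algebraMap A (unitBall K)))).formalLog *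
        (((evalPt₁ (ballNilIdeal K) (W.formalMul n) (W.constantCoeff_formalMul n) t : (ballNilIdeal K).toIdeal) : unitBall K) : K) ^ m =
      (n : K) * ∑' m : ℕ, PowerSeries.coeff m (W.map ((unitBall K).subtype.comp (algebraMap A (unitBall K)))).formalLog *
        ((t : unitBall K) : K) ^ m := by
  induction n, hn using Nat.le_induction with
  | base =>
    have h1 : evalPt₁ (ballNilIdeal K) (W.formalMul 1) (W.constantCoeff_formalMul 1) t = t := by
      have h := (WeierstrassCurve.Pt.val_nsmul 1 (⟨t⟩ : W.Pt (ballNilIdeal K))).symm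
      rwa [one_nsmul] at h
    rw [h1, Nat.cast_one, one_mul]
  | succ n hn ih =>
    rw [WeierstrassCurve.Pt.evalPt₁_formalMul_succ, show addPt (ballNilIdeal K) W.toFormalGroup
        (evalPt₁ (ballNilIdeal K) (W.formalMul n) (W.constantCoeff_formalMul n) t) t =
        evF W (evalPt₁ (ballNilIdeal K) (W.formalMul n) (W.constantCoeff_formalMul n) t) t from rfl,
      tsum_coeff_formalLog_map_evF W hpK, ih]
    push_cast
    ring

/-- ★★ **`pᵐ·log_W(u_m) = log_W(u₀)` along an exact `[p]_W`-division tower** (`[p]_W u_{m+1} = u_m`) of `Ŵ(𝔪_K)`, for `W` over any coefficient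
ring `A` acting on `𝒪_K` — the hypothesis `hu` of `SecondKindColmezFunctionalHodgeLine.tsum_eq_of_hodgeLine_of_pow_mul_tsum_eq` for `G₀ = log_W`.
[cite: SilvermanAEC2009, Thm. IV.6.4] -/
theorem pow_mul_tsum_coeff_formalLog_map_divisionSeq (hpK : ‖(p : K)‖ < 1) (u : ℕ → (ballNilIdeal K).toIdeal)
    (hu : ∀ n, evalPt₁ (ballNilIdeal K) (W.formalMul p) (W.constantCoeff_formalMul p) (u (n + 1)) = u n) (m : ℕ) :
    (p : K) ^ m * ∑' j : ℕ, PowerSeries.coeff j (W.map ((unitBall K).subtype.comp (algebraMap A (unitBall K)))).formalLog *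
        (((u m : (ballNilIdeal K).toIdeal) : unitBall K) : K) ^ j =
      ∑' j : ℕ, PowerSeries.coeff j (W.map ((unitBall K).subtype.comp (algebraMap A (unitBall K)))).formalLog *
        (((u 0 : (ballNilIdeal K).toIdeal) : unitBall K) : K) ^ j := by
  induction m with
  | zero => rw [pow_zero, one_mul]
  | succ m ih =>
    rw [← ih, ← hu m, tsum_coeff_formalLog_map_formalMul W hpK (u (m + 1)) hp.out.one_le, pow_succ, mul_assoc]

/-- **Torsion towers**: if `u₀ = 0` (as a point of `𝔪_K`) then `pᵐ·log_W(u_m) = 0` for all `m`. [cite: SilvermanAEC2009, Thm. IV.6.4] -/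
theorem pow_mul_tsum_coeff_formalLog_map_divisionSeq_eq_zero (hpK : ‖(p : K)‖ < 1) (u : ℕ → (ballNilIdeal K).toIdeal)
    (hu : ∀ n, evalPt₁ (ballNilIdeal K) (W.formalMul p) (W.constantCoeff_formalMul p) (u (n + 1)) = u n)
    (hu0 : (((u 0 : (ballNilIdeal K).toIdeal) : unitBall K) : K) = 0) (m : ℕ) :
    (p : K) ^ m * ∑' j : ℕ, PowerSeries.coeff j (W.map ((unitBall K).subtype.comp (algebraMap A (unitBall K)))).formalLog *
        (((u m : (ballNilIdeal K).toIdeal) : unitBall K) : K) ^ j = 0 := by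
  rw [pow_mul_tsum_coeff_formalLog_map_divisionSeq W hpK u hu m, hu0]
  calc ∑' j : ℕ, PowerSeries.coeff j (W.map ((unitBall K).subtype.comp (algebraMap A (unitBall K)))).formalLog * (0 : K) ^ j
      = ∑' _ : ℕ, (0 : K) := tsum_congr fun j => by
        rcases Nat.eq_zero_or_pos j with rfl | hj
        · rw [PowerSeries.coeff_zero_eq_constantCoeff, WeierstrassCurve.constantCoeff_formalLog, zero_mul]
        · rw [zero_pow hj.ne', mul_zero]
    _ = 0 := tsum_zero

end FormalLog

end Literature.NumberTheory.EllipticCurves
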